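import Summits.QuantumFields.YangMills.Theorems.BalabanUVNodesK0RecordFormatNamesFluctF
import Literature.MathematicalPhysics.QuantumFieldTheory.Balaban1983to89.B12SmallFieldDomain259

/-!
# K0⁷ — THE RECORD-SIDE FORMAT NAMES, EDITION 26 = FLUCTUATION CARRIERS, STAGE 1c (`…FluctRatioC`): THE COMPLEX-PARAMETER, LEBESGUE-REFERENCE FLUCTUATION RATIO WITH THE (P4)∕`s` SOCKET
# (◇ lens-1 g12 NODE v13∕v13.1 «N1 — the s-carrier», nodeO STATUS 2026-08-31 l.5507∕l.5527∕l.5529; this seat's DESIGN WORD l.5531 (D1)–(D6); ◆ CRIT-1 g38 CUT = GO AS INTENT l.5536 with riders (R-a)–(R-d); basename `…FluctRatioC` because `…FluctC` is ed.15c of this lineage)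

Cell `ym-nodeO-ideate` ∕ `ym-balaban-port`, DEFINER seat `ym-nodeO-def-1` (gen 39); `--kind definition --supports stmt-QuantumFields-20541 --as helper`; count-neutral.
[I] = [Balaban1987RG1], [II] = [Balaban1988RG2Cluster].

WHY.  Stage 2's CLOSED carrier `recordFluctInt` (= print's (2.13) `𝐄^{(k+1)}(g_k, U_{k+1}(W_B))` at the record, stage-1b socket `recordFluctIntOf`) is a REAL number at the
REAL record datum `B`: a `Real.log` of an integral against a probability Gaussian with REAL positive-definite precision.  The objects the FE-2 half of ⟨27930⟩ speaks about
(◇'s N1 s-carrier, N2b locality at `s = 0`, N4 joint holomorphy, N7 ψ-analyticity; [II] (1.9)–(1.10), (1.13)–(1.14)) need a SECOND edition in which the decoupling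
parameter `s` and the complexified background `ψ` are SOCKETS and the Gaussian is written against LEBESGUE measure with a COMPLEX symmetric form — print's (2.12) «dB′ = Π db′»
before normalisation.  This file types that edition, Mathlib + built stage-1 names only (no unbuilt olean).

WHAT THIS FILE IS (definitions + `rfl`∕one-line faces + one Fubini factorisation; NEW names; every earlier object untouched — append-only rule):
* §24m (generic, index `ι`): `quadC M x := Σ_i Σ_j x_i M_ij x_j` for a COMPLEX matrix `M` at a REAL point `x`; `gaussIntC χ M E := ∫ x, χ x · cexp (−½·quadC M x + E x) ∂volume`;
  `gaussNormC M := ∫ x, cexp (−½·quadC M x) ∂volume`; ★ `gaussRatioC χ M E := gaussIntC χ M E ∕ gaussNormC M` — the normalised complex-Gaussian expectation of `χ·e^{E}` in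
  Lebesgue-reference form.  JUNK DISCIPLINE (◆ (R-a)): these are TOTAL defs; off the regime `{Re M ≻ 0}` (non-integrable numerator ⇒ Bochner `∫ = 0`; vanishing denominator ⇒
  `z ∕ 0 = 0`) their values are JUNK — every face below carries its regime as a displayed hypothesis; NO `def … : Prop` asserting convergence or non-vanishing is introduced.
  Faces: `gaussIntC_one_zero` (χ ≡ 1, E ≡ 0 ⇒ numerator = denominator, `rfl`-level), `gaussRatioC_one_zero (h : gaussNormC M ≠ 0) : … = 1` (`div_self`, nothing more),
  ★★ `gaussIntC_fromBlocks` ∕ `gaussNormC_fromBlocks` ∕ `gaussRatioC_fromBlocks` — for `ι = ι₁ ⊕ ι₂`, block-diagonal `M = fromBlocks M₁ 0 0 M₂`, product cut-off and additive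
  exponent, the integral (hence the ratio) FACTORISES (`volume_measurePreserving_sumPiEquivProdPi` + `integral_prod_mul`, unconditional) — the engine of ◇'s N2b «locality at
  `s = 0`» ((1.4)'s separation = block-diagonality of the s-weakened form across components).
* §24m′ (record): ★ `chiRem F k K ε₁ x` — print's (2.9) `χ_k = Π_{b ∉ {b₀(c)}} χ(|B′(b)| < ε₁)` READ ON THE REMAINING VARIABLES `x : NonB0Idx F k K → ℝ` (DESIGN WORD (D1): the
  printed cut-off never evaluates a `b₀(c)` row, so it is `C`-free and ψ-free — load-bearing for N7 and N2b); faces `b0_eq_recordB0` (`B12SmallFieldDomain259.b0 = recordB0`, `rfl`)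
  and ★ `chiFluctPrinted_eq_chiRem` (for every field `B′ : VecField (F.P K) k fluctG3` that AGREES WITH `x` on the non-`b₀` bonds — the block hypothesis displayed, ◆ (R-d));
  `cubeMonomial s Q := Π_{q ∈ Q} s q` and `recordSWeight F Mc k K s Y := cubeMonomial s (intCubes F Mc k K Y)` (`s^Y`); ★ `piecesFormC F k K T w ψ : Matrix (NonB0Idx) (NonB0Idx) ℂ
  := (i, j) ↦ Σ_Y w Y · T Y ψ i.1 j.1` — the (P4) pieces `TY n` of `P0CarrierClauses` RE-WEIGHTED and restricted to the non-`b₀` block (pieces UNCHANGED; `w ≡ 1` gives back (P4)'s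
  `TC n ψ = Σ_Y TY n Y ψ` — face `piecesFormC_one_eq` under that clause displayed); ★★ `recordFluctRatioCOf F k K ε₁ T w E g s ψ := gaussRatioC (chiRem …) (piecesFormC … T (w s) ψ)
  (E g s ψ)` — ◇'s N1 SOCKET: `s` enters ONLY through the weights on the (P4) pieces (and, if the modeller wishes, through the exponent socket `E`); ★★ `recordFluctRatioC F Mc k K ε₁ T E g s ψ`
  — the record-pinned edition with `w := recordSWeight F Mc k K` (`s : (Fin 4 → ℤ) → ℂ` on the integer cube labels of `intCubes`).
  SINGLETON-FREE WEIGHTS (◇ lens-1 g12 (E2) ∕ ◆ rider (R-e), nodeO STATUS l.5538∕l.5539∕l.5544): `recordSWeight … s Y := 1` when `Y` lies inside ONE cube (`(intCubes … Y).card ≤ 1`), the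
  monomial `Π_{q ∈ intCubes Y} s q` only for pieces meeting ≥ 2 cubes — so that at the decoupling points `s = 0` off `Z` every cube KEEPS its coercive single-cube block (`M(0)` = the
  single-cube part, face `piecesFormC_recordSWeight_zero`; `M(𝟙) = TC|_{NonB0}`, face `piecesFormC_one_eq`) instead of losing it (all-cubes monomials would make `M(s)` singular exactly
  at N3's evaluation points).  Print's OPERATOR-side convention [II] p.3 weights singletons under the unit Gaussian (2.6); the record's carrier is PRECISION-side — a declared divergence
  (◼ D-K16-2).  Faces `recordSWeight_of_card_le_one`, `recordSWeight_eq_zero` (a multi-cube piece meeting a zeroed cube drops out), and the generic REINDEXING face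
  `gaussIntC_reindex`∕`gaussRatioC_reindex` (transport along `e : ι' ≃ ι`, `volume_measurePreserving_piCongrLeft`) so that a consumer splits `NonB0Idx ≃ (inside c) ⊕ (outside c)`
  and fires `gaussRatioC_fromBlocks` without touching measure theory again (N2b′ = ✓`…K0AxCauchyDecouplingLocality` + these two faces + bookkeeping).
INTENDED BRIDGE (DOCSTRING ONLY today, ◆ (R-b); a THEOREM when `B12Eq216GaussianCarrier` builds and stage 2 lands): at `s ≡ 1` and `ψ_B := recordPairJ F θ k K B` (the record's real
point of the datum `B`), (P2) gives `piecesFormC … (TY n) 1 ψ_B = recordPreckLoc …` on the non-`b₀` block for `B` near `0`, and `recordFluctRatioCOf … 1 ψ_B` equals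
`(recordFluctDataOf …).integral g B` (whose `Real.log` is `recordFluctInt`) — by `integral_gaussFieldPush` and the density form of `gaussProb`.  NOT stated as a `Prop` letter anywhere.

HONEST FRAMING.  Definitions and bookkeeping faces only; NOTHING of Bałaban is asserted, ported or discharged — in particular neither the convergence of `gaussIntC` on
`{Re M ≻ 0}`, nor `gaussNormC M = (2π)^{n∕2}(det M)^{−1∕2}`, nor any holomorphy (N4∕N7), nor the bridge above is claimed here; `recordFluctInt`, (o1)–(o4) are NOT in the tree;
`stub_FE` (XXL) ∕ `stub_P0C` ∕ `stub_G3C` OPEN, ⟨27930⟩ OPEN; K0⁷ ∕ K0ᴬ ∕ K1ᴬ ∕ K3ᴬ OPEN; NODE O not inhabited (0∕1); COUNT 8∕28 · K 1∕4 UNMOVED; finite `𝕋⁴_{L^K}` at fixed ε — NOT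
continuum ∕ ℝ⁴ ∕ OS; **the Yang–Mills mass gap (Clay) is NOT proved by any of this.**  No `sorry`, `instance`, `notation`; standard axioms.
-/

noncomputable section

open scoped BigOperators
open MeasureTheory

namespace Summit.QuantumFields.YangMills.Theorems.K0RecordFormatNames

open Literature.MathematicalPhysics.QuantumFieldTheory.Balaban1983to89
open Literature.MathematicalPhysics.QuantumFieldTheory.Balaban1983to89.Node00
open Literature.MathematicalPhysics.QuantumFieldTheory.Balaban1983to89.T4Continuum (T4Family)

/-! ## §24m  The generic complex-parameter, Lebesgue-reference Gaussian ratio -/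

section Generic

variable {ι : Type*} [Fintype ι]

/-- **`quadC M x := Σ_i Σ_j x_i·M_ij·x_j`** — a COMPLEX symmetric form (`M : Matrix ι ι ℂ`, print's s-weakened `C*Δ^{(k)}C` after complexification of the background) evaluated at a
REAL point `x` (the remaining fluctuation variables). [cite: Balaban1987RG1, (2.12) p.268; Balaban1988RG2Cluster, (1.9)–(1.10) p.4] -/
def quadC (M : Matrix ι ι ℂ) (x : ι → ℝ) : ℂ := ∑ i, ∑ j, (x i : ℂ) * M i j * (x j : ℂ)

/-- **`gaussIntC χ M E := ∫ x, χ(x)·exp(−½·quadC M x + E x) dx`** (Lebesgue measure on `ι → ℝ`; Bochner integral, value `0` when the integrand is not integrable — JUNK off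
`{Re M ≻ 0}`, SAID). Print's (2.12) numerator «∫ dB′ … χ_k exp[…]» before normalisation, with complex parameters allowed. [cite: Balaban1987RG1, (2.12) p.268] -/
def gaussIntC (χ : (ι → ℝ) → ℝ) (M : Matrix ι ι ℂ) (E : (ι → ℝ) → ℂ) : ℂ :=
  ∫ x : ι → ℝ, (χ x : ℂ) * Complex.exp (-(1 / 2 : ℂ) * quadC M x + E x)

/-- **`gaussNormC M := ∫ x, exp(−½·quadC M x) dx`** — the Gaussian normalisation (for `Re M ≻ 0` it is `(2π)^{n∕2}(det M)^{−1∕2}` on the principal branch; NOT claimed here; junk `0`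
when not integrable). [cite: Balaban1987RG1, (2.12) p.268] -/
def gaussNormC (M : Matrix ι ι ℂ) : ℂ :=
  ∫ x : ι → ℝ, Complex.exp (-(1 / 2 : ℂ) * quadC M x)

/-- ★ **`gaussRatioC χ M E := gaussIntC χ M E ∕ gaussNormC M`** — the NORMALISED complex-Gaussian expectation of `χ·e^{E}` in Lebesgue-reference form (= `∫ χ e^{E} dμ_{M⁻¹}` when `M`
is real positive-definite; junk `z ∕ 0 = 0` when the normalisation vanishes — SAID). [cite: Balaban1987RG1, (2.12)–(2.13) p.268] -/
def gaussRatioC (χ : (ι → ℝ) → ℝ) (M : Matrix ι ι ℂ) (E : (ι → ℝ) → ℂ) : ℂ :=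
  gaussIntC χ M E / gaussNormC M

/-- FACE: with `χ ≡ 1` and `E ≡ 0` the numerator IS the normalisation. [cite: Balaban1987RG1, (2.12) p.268 (bookkeeping)] -/
theorem gaussIntC_one_zero (M : Matrix ι ι ℂ) : gaussIntC (fun _ => (1 : ℝ)) M (fun _ => 0) = gaussNormC M := by
  simp only [gaussIntC, gaussNormC, Complex.ofReal_one, one_mul, add_zero]

/-- FACE: hence the ratio is `1` WHEN the normalisation is non-zero (`div_self`; nothing more is claimed). [cite: Balaban1987RG1, (2.12) p.268 (bookkeeping)] -/
theorem gaussRatioC_one_zero (M : Matrix ι ι ℂ) (h : gaussNormC M ≠ 0) : gaussRatioC (fun _ => (1 : ℝ)) M (fun _ => 0) = 1 := by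
  rw [gaussRatioC, gaussIntC_one_zero, div_self h]

end Generic

/-! ### The block factorisation (engine of N2b «locality at `s = 0`») -/

section Blocks

variable {ι₁ ι₂ : Type*} [Fintype ι₁] [Fintype ι₂]

/-- A block-diagonal complex form splits along `ι₁ ⊕ ι₂`. [cite: Balaban1988RG2Cluster, (1.4) p.3, (1.9)–(1.10) p.4] -/
theorem quadC_fromBlocks (M₁ : Matrix ι₁ ι₁ ℂ) (M₂ : Matrix ι₂ ι₂ ℂ) (x : ι₁ ⊕ ι₂ → ℝ) :
    quadC (Matrix.fromBlocks M₁ 0 0 M₂) x = quadC M₁ (fun i => x (Sum.inl i)) + quadC M₂ (fun j => x (Sum.inr j)) := by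
  simp only [quadC, Fintype.sum_sum_type, Matrix.fromBlocks_apply₁₁, Matrix.fromBlocks_apply₁₂, Matrix.fromBlocks_apply₂₁,
    Matrix.fromBlocks_apply₂₂, Matrix.zero_apply, mul_zero, zero_mul, Finset.sum_const_zero, add_zero, zero_add]

/-- ★★ **FUBINI FACTORISATION**: for block-diagonal `M`, a product cut-off and an additive exponent, `gaussIntC` over `ι₁ ⊕ ι₂` is the PRODUCT of the two block integrals
(`volume_measurePreserving_sumPiEquivProdPi` + `integral_prod_mul`; unconditional — both sides are the same junk when a factor is not integrable).
[cite: Balaban1988RG2Cluster, (1.4) p.3, (1.9)–(1.10) p.4] -/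
theorem gaussIntC_fromBlocks (χ₁ : (ι₁ → ℝ) → ℝ) (χ₂ : (ι₂ → ℝ) → ℝ) (M₁ : Matrix ι₁ ι₁ ℂ) (M₂ : Matrix ι₂ ι₂ ℂ)
    (E₁ : (ι₁ → ℝ) → ℂ) (E₂ : (ι₂ → ℝ) → ℂ) :
    gaussIntC (fun x => χ₁ (fun i => x (Sum.inl i)) * χ₂ (fun j => x (Sum.inr j))) (Matrix.fromBlocks M₁ 0 0 M₂)
        (fun x => E₁ (fun i => x (Sum.inl i)) + E₂ (fun j => x (Sum.inr j)))
      = gaussIntC χ₁ M₁ E₁ * gaussIntC χ₂ M₂ E₂ := by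
  -- the integrand factorises pointwise
  set f : (ι₁ → ℝ) → ℂ := fun y => (χ₁ y : ℂ) * Complex.exp (-(1 / 2 : ℂ) * quadC M₁ y + E₁ y) with hf
  set g : (ι₂ → ℝ) → ℂ := fun z => (χ₂ z : ℂ) * Complex.exp (-(1 / 2 : ℂ) * quadC M₂ z + E₂ z) with hg
  have hpt : ∀ x : ι₁ ⊕ ι₂ → ℝ,
      ((χ₁ (fun i => x (Sum.inl i)) * χ₂ (fun j => x (Sum.inr j)) : ℝ) : ℂ) *
          Complex.exp (-(1 / 2 : ℂ) * quadC (Matrix.fromBlocks M₁ 0 0 M₂) x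
            + (E₁ (fun i => x (Sum.inl i)) + E₂ (fun j => x (Sum.inr j))))
        = f (fun i => x (Sum.inl i)) * g (fun j => x (Sum.inr j)) := by
    intro x
    rw [quadC_fromBlocks, hf, hg, Complex.ofReal_mul]
    have : -(1 / 2 : ℂ) * (quadC M₁ (fun i => x (Sum.inl i)) + quadC M₂ (fun j => x (Sum.inr j)))
        + (E₁ (fun i => x (Sum.inl i)) + E₂ (fun j => x (Sum.inr j)))
        = (-(1 / 2 : ℂ) * quadC M₁ (fun i => x (Sum.inl i)) + E₁ (fun i => x (Sum.inl i)))
          + (-(1 / 2 : ℂ) * quadC M₂ (fun j => x (Sum.inr j)) + E₂ (fun j => x (Sum.inr j))) := by ring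
    rw [this, Complex.exp_add]
    ring
  unfold gaussIntC
  simp_rw [hpt]
  -- transport to the product space and apply Fubini
  have hmp := volume_measurePreserving_sumPiEquivProdPi (fun _ : ι₁ ⊕ ι₂ => ℝ)
  have key : ∫ x : ι₁ ⊕ ι₂ → ℝ, f (fun i => x (Sum.inl i)) * g (fun j => x (Sum.inr j))
      = ∫ p : (ι₁ → ℝ) × (ι₂ → ℝ), f p.1 * g p.2 := by
    rw [← hmp.integral_comp' (fun p : (ι₁ → ℝ) × (ι₂ → ℝ) => f p.1 * g p.2)]
    rfl
  rw [key, Measure.volume_eq_prod, integral_prod_mul]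

/-- The normalisation factorises likewise. [cite: Balaban1988RG2Cluster, (1.4) p.3 (bookkeeping)] -/
theorem gaussNormC_fromBlocks (M₁ : Matrix ι₁ ι₁ ℂ) (M₂ : Matrix ι₂ ι₂ ℂ) :
    gaussNormC (Matrix.fromBlocks M₁ 0 0 M₂) = gaussNormC M₁ * gaussNormC M₂ := by
  have h := gaussIntC_fromBlocks (fun _ : ι₁ → ℝ => (1 : ℝ)) (fun _ : ι₂ → ℝ => (1 : ℝ)) M₁ M₂ (fun _ => 0) (fun _ => 0)
  simp only [mul_one, add_zero] at h
  rw [← gaussIntC_one_zero, ← gaussIntC_one_zero, ← gaussIntC_one_zero]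
  exact h

/-- ★★ **THE RATIO FACTORISES** (no non-vanishing hypothesis needed: `(a·b)∕(c·d) = (a∕c)·(b∕d)` holds with `z ∕ 0 = 0`). This is the kernel form of [II]'s «system of separated
equations … renders the term equal to 0»: at `s = 0` off a component the s-weakened form is block-diagonal and the expectation is a product of component expectations.
[cite: Balaban1988RG2Cluster, (1.4) p.3, (1.9)–(1.10) p.4] -/
theorem gaussRatioC_fromBlocks (χ₁ : (ι₁ → ℝ) → ℝ) (χ₂ : (ι₂ → ℝ) → ℝ) (M₁ : Matrix ι₁ ι₁ ℂ) (M₂ : Matrix ι₂ ι₂ ℂ)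
    (E₁ : (ι₁ → ℝ) → ℂ) (E₂ : (ι₂ → ℝ) → ℂ) :
    gaussRatioC (fun x => χ₁ (fun i => x (Sum.inl i)) * χ₂ (fun j => x (Sum.inr j))) (Matrix.fromBlocks M₁ 0 0 M₂)
        (fun x => E₁ (fun i => x (Sum.inl i)) + E₂ (fun j => x (Sum.inr j)))
      = gaussRatioC χ₁ M₁ E₁ * gaussRatioC χ₂ M₂ E₂ := by
  rw [gaussRatioC, gaussRatioC, gaussRatioC, gaussIntC_fromBlocks, gaussNormC_fromBlocks, mul_div_mul_comm]

end Blocks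

/-! ### Reindexing (so that a consumer can present any index type as `ι₁ ⊕ ι₂` and fire the factorisation) -/

section Reindex

variable {ι ι' : Type*} [Fintype ι] [Fintype ι']

/-- The complex form is invariant under relabelling the coordinates. [cite: Balaban1988RG2Cluster, (1.4) p.3 (bookkeeping)] -/
theorem quadC_submatrix_equiv (e : ι' ≃ ι) (M : Matrix ι ι ℂ) (x : ι → ℝ) :
    quadC (M.submatrix e e) (fun a => x (e a)) = quadC M x := by
  unfold quadC
  simp only [Matrix.submatrix_apply]
  exact Fintype.sum_equiv e _ _ fun a => Fintype.sum_equiv e _ _ fun b => rfl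

/-- ★ **REINDEXING FACE**: `gaussIntC` is invariant under relabelling the coordinates along `e : ι' ≃ ι` (Lebesgue measure on `ι → ℝ` is the image of Lebesgue measure on `ι' → ℝ`,
`volume_measurePreserving_piCongrLeft`). [cite: Balaban1988RG2Cluster, (1.4) p.3 (bookkeeping)] -/
theorem gaussIntC_reindex (e : ι' ≃ ι) (χ : (ι → ℝ) → ℝ) (M : Matrix ι ι ℂ) (E : (ι → ℝ) → ℂ) :
    gaussIntC (fun y : ι' → ℝ => χ (fun i => y (e.symm i))) (M.submatrix e e) (fun y => E (fun i => y (e.symm i))) = gaussIntC χ M E := by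
  unfold gaussIntC
  have h := volume_measurePreserving_piCongrLeft (fun _ : ι' => ℝ) e.symm
  rw [← h.integral_comp']
  congr 1
  funext x
  have hfun : (MeasurableEquiv.piCongrLeft (fun _ : ι' => ℝ) e.symm) x = fun a => x (e a) := by
    funext a
    rw [MeasurableEquiv.coe_piCongrLeft, Equiv.piCongrLeft_apply (P := fun _ : ι' => ℝ) (e := e.symm) x a,
      eq_rec_constant, Equiv.symm_symm]
  simp only [hfun, Equiv.apply_symm_apply, quadC_submatrix_equiv]

/-- The normalisation is invariant under relabelling. [cite: Balaban1988RG2Cluster, (1.4) p.3 (bookkeeping)] -/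
theorem gaussNormC_reindex (e : ι' ≃ ι) (M : Matrix ι ι ℂ) : gaussNormC (M.submatrix e e) = gaussNormC M := by
  rw [← gaussIntC_one_zero, ← gaussIntC_one_zero]
  exact gaussIntC_reindex e (fun _ => (1 : ℝ)) M (fun _ => 0)

/-- ★ **REINDEXING FACE for the ratio.** [cite: Balaban1988RG2Cluster, (1.4) p.3 (bookkeeping)] -/
theorem gaussRatioC_reindex (e : ι' ≃ ι) (χ : (ι → ℝ) → ℝ) (M : Matrix ι ι ℂ) (E : (ι → ℝ) → ℂ) :
    gaussRatioC (fun y : ι' → ℝ => χ (fun i => y (e.symm i))) (M.submatrix e e) (fun y => E (fun i => y (e.symm i))) = gaussRatioC χ M E := by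
  rw [gaussRatioC, gaussRatioC, gaussIntC_reindex, gaussNormC_reindex]

end Reindex

/-! ## §24m′  The record instances: `χ_k` on the remaining variables, the (P4)∕`s` socket, the record fluctuation ratio -/

variable (F : T4Family)

/-- The 𝔤-carrier of the fluctuation variable `B′` at the record: `ℝ³` with its Euclidean structure (for `𝔰𝔲(2)` the operator norm of `Σ_a z_a·su2Gen a` IS `|z|`, so the (2.9) cut-off
needs no conversion constant — ▶ PT-A-1 g7). [cite: Balaban1987RG1, (2.4) p.266, (2.9) p.266] -/
abbrev fluctG3 : Type := EuclideanSpace ℝ (Fin 3)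

/-- FACE (`rfl`): the reader's distinguished bond `B12SmallFieldDomain259.b0` and this lineage's `recordB0` are the SAME function (both `AveragingRT.line c ((L−1)∕2)` — the central crossing bond).
[cite: Balaban1987RG1, p.267] -/
theorem b0_eq_recordB0 (k K : ℕ) (c : PBond (F.P K) (k + 1)) : B12SmallFieldDomain259.b0 c = recordB0 F k K c := rfl

open Classical in
/-- ★ **`χ_k` ON THE REMAINING VARIABLES**: `chiRem F k K ε₁ x := 1` if `|x(b, ·)| < ε₁` (Euclidean norm on the three colour components) at EVERY non-`b₀` bond `b`, else `0` — print's (2.9)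
`Π_{b ∈ T⁽ᵏ⁾∖{b₀(c)}} χ(|B′(b)| < ε₁)` read directly on `x : NonB0Idx F k K → ℝ` («the remaining variables B», p.268). It is `C`-FREE and background-free BY CONSTRUCTION (DESIGN WORD (D1)).
[cite: Balaban1987RG1, (2.9) p.266, p.268] -/
def chiRem (k K : ℕ) (ε₁ : ℝ) (x : NonB0Idx F k K → ℝ) : ℝ :=
  if ∀ (b : PBond (F.P K) k) (hb : b ∉ Set.range (recordB0 F k K)), √(∑ a : Fin 3, x ⟨(b, a), hb⟩ ^ 2) < ε₁ then 1 else 0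

/-- `χ_rem ∈ {0, 1}`, in particular `0 ≤ χ_rem ≤ 1`. [cite: Balaban1987RG1, (2.9) p.266] -/
theorem chiRem_nonneg_le_one (k K : ℕ) (ε₁ : ℝ) (x : NonB0Idx F k K → ℝ) : 0 ≤ chiRem F k K ε₁ x ∧ chiRem F k K ε₁ x ≤ 1 := by
  unfold chiRem
  split_ifs <;> norm_num

/-- ★ FACE — **THE PRINTED CUT-OFF READS THE REMAINING VARIABLES DIRECTLY**: for every field `B′` on ALL bonds that AGREES WITH `x` on the non-`b₀` bonds (the displayed block hypothesis —
e.g. `B′ = C·x` for ANY elimination matrix `C` with identity non-`b₀` block, whatever its `b₀(c)` rows), `chiFluctPrinted ε₁ B′ = chiRem F k K ε₁ x`. [cite: Balaban1987RG1, (2.9) p.266, p.268] -/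
theorem chiFluctPrinted_eq_chiRem (k K : ℕ) (ε₁ : ℝ) (x : NonB0Idx F k K → ℝ) (B' : VecField (F.P K) k fluctG3)
    (hB : ∀ (b : PBond (F.P K) k) (hb : b ∉ Set.range (recordB0 F k K)) (a : Fin 3), B' b a = x ⟨(b, a), hb⟩) :
    B12SmallFieldDomain259.chiFluctPrinted ε₁ B' = chiRem F k K ε₁ x := by
  classical
  unfold B12SmallFieldDomain259.chiFluctPrinted chiRem
  have hiff : (∀ b : PBond (F.P K) k, (¬ ∃ c : PBond (F.P K) (k + 1), B12SmallFieldDomain259.b0 c = b) → ‖B' b‖ < ε₁)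
      ↔ ∀ (b : PBond (F.P K) k) (hb : b ∉ Set.range (recordB0 F k K)), √(∑ a : Fin 3, x ⟨(b, a), hb⟩ ^ 2) < ε₁ := by
    constructor
    · intro h b hb
      have hb' : ¬ ∃ c : PBond (F.P K) (k + 1), B12SmallFieldDomain259.b0 c = b := by
        rintro ⟨c, hc⟩; exact hb ⟨c, hc⟩
      have := h b hb'
      rw [EuclideanSpace.norm_eq] at this
      convert this using 3 with a
      rw [hB b hb a, Real.norm_eq_abs, sq_abs]
    · intro h b hb'
      have hb : b ∉ Set.range (recordB0 F k K) := by
        rintro ⟨c, hc⟩; exact hb' ⟨c, hc⟩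
      have := h b hb
      rw [EuclideanSpace.norm_eq]
      convert this using 3 with a
      rw [hB b hb a, Real.norm_eq_abs, sq_abs]
  simp only [hiff]

/-- **`s^Q := Π_{q ∈ Q} s q`** — the monomial of the decoupling parameters over a finite set of integer cube labels. [cite: Balaban1988RG2Cluster, (1.9) p.4] -/
def cubeMonomial (s : (Fin 4 → ℤ) → ℂ) (Q : Finset (Fin 4 → ℤ)) : ℂ := ∏ q ∈ Q, s q

/-- `s ≡ 1 ⇒ s^Q = 1`. [cite: Balaban1988RG2Cluster, (1.9) p.4 (bookkeeping)] -/
theorem cubeMonomial_one (Q : Finset (Fin 4 → ℤ)) : cubeMonomial (fun _ => 1) Q = 1 := by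
  simp [cubeMonomial]

/-- A monomial over a set containing a zeroed label vanishes. [cite: Balaban1988RG2Cluster, (1.9)–(1.10) p.4 (bookkeeping)] -/
theorem cubeMonomial_eq_zero (s : (Fin 4 → ℤ) → ℂ) (Q : Finset (Fin 4 → ℤ)) (hq : ∃ q ∈ Q, s q = 0) : cubeMonomial s Q = 0 := by
  obtain ⟨q, hqQ, hq0⟩ := hq
  exact Finset.prod_eq_zero hqQ hq0

/-- **`s^Y` AT THE RECORD, SINGLETON-FREE** (◇ (E2) ∕ ◆ (R-e)): `recordSWeight F Mc k K s Y := 1` if the domain `Y` lies inside ONE cube (`(intCubes F Mc k K Y).card ≤ 1`), else the monomial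
`Π_{q ∈ intCubes Y} s q` over its integer cubes — so that setting `s = 0` on a cube removes only the MULTI-cube pieces meeting it and every cube keeps its single-cube (coercive, (P5ᶜ) at
`Z := {□}`) block.  PRECISION-side convention; print's operator-side (2.6) weighting of singletons is a declared divergence (◼ D-K16-2). [cite: Balaban1988RG2Cluster, (1.9) p.4, p.3] -/
def recordSWeight (Mc k K : ℕ) (s : (Fin 4 → ℤ) → ℂ) (Y : (recordDomSys F Mc k K).Dom) : ℂ :=
  if (intCubes F Mc k K Y).card ≤ 1 then 1 else cubeMonomial s (intCubes F Mc k K Y)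

/-- `s ≡ 1 ⇒` every record weight is `1`. [cite: Balaban1988RG2Cluster, (1.9) p.4 (bookkeeping)] -/
theorem recordSWeight_one (Mc k K : ℕ) (Y : (recordDomSys F Mc k K).Dom) : recordSWeight F Mc k K (fun _ => 1) Y = 1 := by
  unfold recordSWeight
  split_ifs
  · rfl
  · exact cubeMonomial_one _

/-- Single-cube pieces are NEVER weighted. [cite: Balaban1988RG2Cluster, (1.9) p.4 (bookkeeping)] -/
theorem recordSWeight_of_card_le_one (Mc k K : ℕ) (s : (Fin 4 → ℤ) → ℂ) (Y : (recordDomSys F Mc k K).Dom) (h : (intCubes F Mc k K Y).card ≤ 1) :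
    recordSWeight F Mc k K s Y = 1 := by
  simp [recordSWeight, h]

/-- A multi-cube piece meeting a ZEROED cube drops out (the decoupling at `s = 0` off `Z`). [cite: Balaban1988RG2Cluster, (1.9)–(1.10) p.4] -/
theorem recordSWeight_eq_zero (Mc k K : ℕ) (s : (Fin 4 → ℤ) → ℂ) (Y : (recordDomSys F Mc k K).Dom) (h2 : 2 ≤ (intCubes F Mc k K Y).card)
    (hq : ∃ q ∈ intCubes F Mc k K Y, s q = 0) : recordSWeight F Mc k K s Y = 0 := by
  have h : ¬ (intCubes F Mc k K Y).card ≤ 1 := by omega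
  simp only [recordSWeight, h, if_false]
  exact cubeMonomial_eq_zero s _ hq

/-- At `s ≡ 0` the weight is the indicator of the single-cube pieces. [cite: Balaban1988RG2Cluster, (1.4) p.3, (1.9) p.4 (bookkeeping)] -/
theorem recordSWeight_zero (Mc k K : ℕ) (Y : (recordDomSys F Mc k K).Dom) :
    recordSWeight F Mc k K (fun _ => 0) Y = if (intCubes F Mc k K Y).card ≤ 1 then 1 else 0 := by
  unfold recordSWeight
  split_ifs with h
  · rfl
  · apply cubeMonomial_eq_zero
    have hne : (intCubes F Mc k K Y).Nonempty := by
      rw [← Finset.card_pos]; omega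
    obtain ⟨q, hq⟩ := hne
    exact ⟨q, hq, rfl⟩

/-- ★ **THE (P4)∕`s` SOCKET — the re-weighted pieces on the non-`b₀` block**: `piecesFormC F k K T w ψ (i, j) := Σ_Y w Y · T Y ψ i.1 j.1` for a piece family `T : D → Ψ → FluctIdx → FluctIdx → ℂ`
(intended: `D := (recordDomSys F Mc k K).Dom`, `T := TY n` of `P0CarrierClauses`, `Ψ := Sect2.CPair (F.P K) (MatA 2)`) and weights `w : D → ℂ` (intended: `w := recordSWeight F Mc k K s`).
The pieces are UNCHANGED; `s` enters ONLY through `w` (DESIGN WORD (D3)). [cite: Balaban1987RG1, (1.7) p.261, (2.11)–(2.12) pp.267–268; Balaban1988RG2Cluster, (1.9) p.4] -/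
def piecesFormC {D Ψ : Type*} [Fintype D] (k K : ℕ) (T : D → Ψ → FluctIdx F k K → FluctIdx F k K → ℂ) (w : D → ℂ) (ψ : Ψ) :
    Matrix (NonB0Idx F k K) (NonB0Idx F k K) ℂ :=
  fun i j => ∑ Y, w Y * T Y ψ i.1 j.1

/-- FACE: at `w ≡ 1` the socket is the plain sum of the pieces on the non-`b₀` block … [cite: Balaban1987RG1, (2.11)–(2.12) pp.267–268 (bookkeeping)] -/
theorem piecesFormC_one {D Ψ : Type*} [Fintype D] (k K : ℕ) (T : D → Ψ → FluctIdx F k K → FluctIdx F k K → ℂ) (ψ : Ψ) (i j : NonB0Idx F k K) :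
    piecesFormC F k K T (fun _ => 1) ψ i j = ∑ Y, T Y ψ i.1 j.1 := by
  simp [piecesFormC]

/-- … hence, UNDER (P4)'s first clause `TC ψ = Σ_Y TY Y ψ` (displayed hypothesis), the total carrier `TC` restricted to the non-`b₀` block. [cite: Balaban1987RG1, (2.11)–(2.12) pp.267–268 (bookkeeping)] -/
theorem piecesFormC_one_eq {D Ψ : Type*} [Fintype D] (k K : ℕ) (T : D → Ψ → FluctIdx F k K → FluctIdx F k K → ℂ) (TC : Ψ → FluctIdx F k K → FluctIdx F k K → ℂ)
    (hP4 : ∀ (ψ : Ψ) (i j : FluctIdx F k K), TC ψ i j = ∑ Y, T Y ψ i j) (ψ : Ψ) (i j : NonB0Idx F k K) :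
    piecesFormC F k K T (fun _ => 1) ψ i j = TC ψ i.1 j.1 := by
  rw [piecesFormC_one, hP4]

/-- FACE — **`M(0)` = THE SINGLE-CUBE PART**: at `s ≡ 0` the record-weighted socket keeps exactly the pieces inside one cube (block-diagonal across cubes once the consumer feeds (P4)'s support
clause; coercive cube by cube by (P5ᶜ) at `Z := {□}` — both displayed THERE, not here). [cite: Balaban1988RG2Cluster, (1.4) p.3, (1.9)–(1.10) p.4] -/
theorem piecesFormC_recordSWeight_zero {Ψ : Type*} (Mc k K : ℕ) (T : (recordDomSys F Mc k K).Dom → Ψ → FluctIdx F k K → FluctIdx F k K → ℂ) (ψ : Ψ)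
    (i j : NonB0Idx F k K) :
    piecesFormC F k K T (recordSWeight F Mc k K (fun _ => 0)) ψ i j
      = ∑ Y ∈ Finset.univ.filter (fun Y => (intCubes F Mc k K Y).card ≤ 1), T Y ψ i.1 j.1 := by
  simp only [piecesFormC, recordSWeight_zero, ite_mul, one_mul, zero_mul]
  rw [Finset.sum_filter]

/-- ★★ **◇'s N1 SOCKET — THE COMPLEX-PARAMETER RECORD FLUCTUATION RATIO**: `recordFluctRatioCOf F k K ε₁ T w E g s ψ := gaussRatioC (chiRem F k K ε₁) (piecesFormC F k K T (w s) ψ) (E g s ψ)`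
— print's (2.12)∕(2.13) expectation `∫ χ_k exp[𝐏 + {…}] dμ_{C^{(k)}}` in Lebesgue-reference form with the s-weakened complexified precision `Σ_Y s^Y·T_Y(ψ)` (pieces = the P0-ℂ letter's (P4)
pieces) and an exponent socket `E`.  TOTAL; junk off `{Re (piecesFormC …) ≻ 0}` ∕ non-integrable exponent (◆ (R-a)).  INTENDED BRIDGE (docstring only, ◆ (R-b)): at `s ≡ 1`, `ψ_B :=
recordPairJ F θ k K B`, with `T := TY n` and `E` the complexified `𝐏_rec + {…}_rec`, this is `(recordFluctDataOf …).integral g B` for `B` near `0` ((P2) + `integral_gaussFieldPush`) — to be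
PROVED at stage 2, never assumed. [cite: Balaban1987RG1, (2.12)–(2.13) p.268; Balaban1988RG2Cluster, (1.9)–(1.10) p.4, (1.13)–(1.14) p.5] -/
def recordFluctRatioCOf {D Ψ S : Type*} [Fintype D] (k K : ℕ) (ε₁ : ℝ) (T : D → Ψ → FluctIdx F k K → FluctIdx F k K → ℂ) (w : S → D → ℂ)
    (E : ℝ → S → Ψ → (NonB0Idx F k K → ℝ) → ℂ) (g : ℝ) (s : S) (ψ : Ψ) : ℂ :=
  gaussRatioC (chiRem F k K ε₁) (piecesFormC F k K T (w s) ψ) (E g s ψ)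

/-- ★★ **THE RECORD-PINNED EDITION**: decoupling parameters `s : (Fin 4 → ℤ) → ℂ` on the integer cube labels, weights `s^Y := recordSWeight F Mc k K s Y`, pieces indexed by the record's
domain system `(recordDomSys F Mc k K).Dom`. [cite: Balaban1987RG1, (2.12)–(2.13) p.268; Balaban1988RG2Cluster, (1.9)–(1.10) p.4] -/
def recordFluctRatioC {Ψ : Type*} (Mc k K : ℕ) (ε₁ : ℝ) (T : (recordDomSys F Mc k K).Dom → Ψ → FluctIdx F k K → FluctIdx F k K → ℂ)
    (E : ℝ → ((Fin 4 → ℤ) → ℂ) → Ψ → (NonB0Idx F k K → ℝ) → ℂ) (g : ℝ) (s : (Fin 4 → ℤ) → ℂ) (ψ : Ψ) : ℂ :=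
  recordFluctRatioCOf F k K ε₁ T (recordSWeight F Mc k K) E g s ψ

/-- FACE (`rfl`): the pinned edition unfolds to the socket. [cite: Balaban1987RG1, (2.13) p.268 (bookkeeping)] -/
theorem recordFluctRatioC_eq {Ψ : Type*} (Mc k K : ℕ) (ε₁ : ℝ) (T : (recordDomSys F Mc k K).Dom → Ψ → FluctIdx F k K → FluctIdx F k K → ℂ)
    (E : ℝ → ((Fin 4 → ℤ) → ℂ) → Ψ → (NonB0Idx F k K → ℝ) → ℂ) (g : ℝ) (s : (Fin 4 → ℤ) → ℂ) (ψ : Ψ) :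
    recordFluctRatioC F Mc k K ε₁ T E g s ψ = gaussRatioC (chiRem F k K ε₁) (piecesFormC F k K T (recordSWeight F Mc k K s) ψ) (E g s ψ) := rfl

/-- FACE: at `s ≡ 1` the pinned edition's precision is the UNWEIGHTED sum of the pieces (the weights are all `1`). [cite: Balaban1988RG2Cluster, (1.9) p.4 (bookkeeping)] -/
theorem recordFluctRatioC_one {Ψ : Type*} (Mc k K : ℕ) (ε₁ : ℝ) (T : (recordDomSys F Mc k K).Dom → Ψ → FluctIdx F k K → FluctIdx F k K → ℂ)
    (E : ℝ → ((Fin 4 → ℤ) → ℂ) → Ψ → (NonB0Idx F k K → ℝ) → ℂ) (g : ℝ) (ψ : Ψ) :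
    recordFluctRatioC F Mc k K ε₁ T E g (fun _ => 1) ψ = gaussRatioC (chiRem F k K ε₁) (piecesFormC F k K T (fun _ => 1) ψ) (E g (fun _ => 1) ψ) := by
  rw [recordFluctRatioC_eq]
  congr 2
  funext Y
  exact recordSWeight_one F Mc k K Y

end Summit.QuantumFields.YangMills.Theorems.K0RecordFormatNames

end
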